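import Literature.MathematicalPhysics.QuantumFieldTheory.Balaban1983to89.B8Eq178Averages

/-!
# Bałaban, *Averaging operations for lattice gauge theories* (CMP 98) — p. 50, the sentence after Proposition 10:
«u′ belongs to the class Λ_k(C₅α₄)», and p. 45: «the product u′u₁ belongs to some class Λ_k(O(1)(α₃ + α₄))», AS MEMBERSHIP
STATEMENTS IN THE TYPED CLASS `Λ_k(U₀, ·)` AT A GENERAL BACKGROUND

statement-level skeleton of published theorems with citation tags; proofs where landed; nothing here is a claim about the
Yang–Mills mass gap.

CITATION HEADER.  Cell `lit-balaban`, Phase-2 proof seat p05 (gen 3), third file.  Source: T. Bałaban, *Averaging operations for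
lattice gauge theories*, Commun. Math. Phys. **98**, 17–51 (1985) [Balaban1985Averaging] (cell paper B7; journal page = PDF page
+ 16), p. 50 [PDF 34] read on the render `b2b-balaban-ref1/pages/1985-cmp98-averaging/1985-cmp98-averaging-p034-x2.png` (this
seat, 2026-08-21), pp. 44–45 [PDF 28–29] ((166)–(167), (176)–(179)) and p. 49 [PDF 33] ((203)–(204)) as quoted in the companions.

THE PRINTED TEXT (p. 50, verbatim): "**Proposition 10.** There exist positive constants `C₄, C₅, c₆` such that for arbitrary
configurations `U₀, u′, u₁` satisfying (52), (176), (177), (166), (167) with `α₀, α₃, α₄ ≦ c₆` the bounds (203), (204) hold for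
`j ≦ k`.  This result implies in particular that the configuration `u′` belongs to the class `Λ_k(C₅α₄)`."  p. 45 (after
(177)): "We would like to know that if `u′` is such a configuration and `u₁` belongs to a class `Λ_k(α₃)`, then the product `u′u₁`
belongs to some class `Λ_k(O(1)(α₃ + α₄))` also."  The class (p. 44):
"(166) `|u^j − 1| < α₃` … (167) `|(\overline{R₀u^j})⁻¹(x_{j+1})(R̄^j_{0,x_{j+1}}\overline{R₀u^j})(x_j) − 1| < α₃L^{j+1}η`,
`x_{j+1} ∈ Ω^{(j+1)}, x_j ∈ B(x_{j+1}), j = 0, 1, …, k − 1` … the class `Λ_k(U₀, α₃)`" (`B7Eq167Flat.InLambda L U₀ u k α₃ η =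
Cond166 ∧ Cond167`); (203) "`|(ũ′ʲ)⁻¹(c₋)R̄ʲ_{0,c}ũ′ʲ(c₊) − 1| < α₄Lʲη + C₄β(Lʲη)²`" ("the right side of (203) can be estimated by
`2α₄Lʲη`"), (204) "`|ũ′ʲ − 1| < α₄ + 2C′₅α₄(Lη + L²η + … + Lʲη)`" ("`≦ α₄(1 + 4C′₅) = C₅α₄`"), `ũ′ʲ = \overline{R₀u′u₁}ʲ
(\overline{R₀u₁}ʲ)⁻¹` (178).

WHAT THE TREE HAD.  Proposition 10 is kernel-proved at a general background (`B7Prop10General.prop10_general`, closed forms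
`prop10_general'`: for `j ≤ k`, `CovBondBd (Ū₀ʲ) (ũ′ʲ) (2α₄Lʲη)` and `SiteBd (ũ′ʲ) (C₆α₄)`, `C₆ = C₅ + 1`) and at `U₀ = 1`
(`B7Prop10Flat.prop10_flat'`).  The closing sentence was recorded only through these closed forms — `B7Prop10Flat` READING (e):
"(166) for the averages of `u′` is (204) `≤ C₅α₄` with `u₁ = 1`; (167) is a tree-path condition while (203) bounds single coarse
bonds … — not typed as an `InLambda` statement" (audit cell `pub-balaban`, census C-b07g22-2 (F4) and note N-B7-F2: summing (203)
along the tree contour `Γ_{x_{j+1},x_j}` (`≤ d(L − 1)` level-`j` bonds) gives the (167)-quantity `≤ 2d(L−1)α₄Lʲη(1 + o(1))`, so the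
class constant is `max(C₅, ≈2d)·α₄` rather than the printed `C₅α₄` unless `C′₅ ≳ d/2`).

WHAT THIS FILE PROVES (theorems only; nothing restated, the companions are used BY NAME).
* §1 `R0avg_one_right`, `vtilG_one_right`, **`utilG_one_right`**: with `u₁ = 1` the averages (178)/(179) `ũ′ʲ` ARE the averages
  (79)/(80) `\overline{R₀u′}ʲ` of `u′` itself (`\overline{R₀1}ʲ = 1`, `B7Eq167Flat.uavg_one_right`) — print's "with `u₁ = 1`" reading
  of the sentence.
* §2 **the covariant telescoping along a lattice word of positive bonds** (the mechanism of (182)/(186) p. 46, "`v′⁻¹(y)(R_{0,y}v′)(x) =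
  ∏_{b⊂Γ_{y,x}} R(V₀(Γ_{y,b₋}))V′_b`"): at a background with values in `U1` (rotations are contractions), the bond condition (180b)
  `CovBondBd V₀ v a` gives, for every word `Γ` of positive letters from `x`,
  `‖v(x)⁻¹R(V₀(Γ))v(x + disp Γ) − 1‖ ≤ (1 + a)^{|Γ|} − 1` (`covWalk_pos`), `≤ 2|Γ|a` once `|Γ|a ≤ 1` (`covWalk_pos_linear`); the tree
  contours `Γ_{y,y+r}`, `r ∈ [0, L)^d`, are positive words of length `≤ d(L − 1) ≤ dL` (`treeWord_boxVec_pos`), whence the block form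
  `covBlock_of_covBondBd`: `‖v(Lz)⁻¹(R_{0,Lz}v)(Lz + r) − 1‖ ≤ 2dL·a` — N-B7-F2's count, kernel-checked.
* §3 **the sentence itself**, `inLambda_of_prop10_general`: under the hypotheses of `B7Prop10General.prop10_general` with `u₁ = 1`
  (so `α₃ = 0`: `1 ∈ Λ_k(U₀, 0)`, `B7Eq167Flat.inLambda_one`), `u′ ∈ Λ_k(U₀, C₆α₄)`, i.e. `InLambda L U₀ u′ k (C6 d * α₄) η`:
  (166) for `\overline{R₀u′}ʲ`, `j ≤ k`, is (204) `≤ C₆α₄`; (167), `j < k`, is §2 applied to (203) at the background `Ū₀ʲ`: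
  `≤ 2dL·2α₄Lʲη = 4d·α₄L^{j+1}η ≤ C₆α₄L^{j+1}η` since `4d ≤ C₆ = 2 + 256(d + 1)` — IN THE TREE'S CONSTANTS THE PRINTED SHAPE
  «Λ_k(C·α₄)» HOLDS WITH THE SAME `C = C₆` AS (204), no `max(C₅, 2d)` being needed (the tree's `C₅ = 1 + 256(d+1)` already exceeds
  `2d`; N-B7-F2's caveat concerns print's unspecified `C′₅`).  `inLambda_of_prop10_general_of52`: the same with the level hypotheses
  discharged from (52) by Proposition 2 (`B7Prop10General.levels_of52`), `η = L^{−k}`.  `inLambda_of_prop10_flat`: the flat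
  background `U₀ = 1` ((177) = `BondBd u′ (α₄η)`; no `α₀`).
* §4 **the p. 45 sentence**, `inLambda_mul_of_prop10_general`: under the hypotheses of `prop10_general` (general `u₁ ∈ Λ_k(U₀, α₃)`),
  `u′u₁ ∈ Λ_k(U₀, 2C₆(α₃ + α₄))`: by (178) `\overline{R₀u′u₁}ʲ = ũ′ʲ·\overline{R₀u₁}ʲ` (r05's `B8Eq178Averages.utilG_eq_uavg_mul_inv`,
  (178) = (179) at a general background), (166) for the product is (204) × (166), and (167) for the product is the splitting (182)
  `R(ū₁ʲ(y)⁻¹)[ũ′ʲ-quantity]·[ū₁ʲ-quantity]` (`prod_cov_split`) with the two factors bounded by §2 + (203) and by (167) for `u₁`.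
READINGS (recorded; none is an objection to print beyond N-B7-F2).  (a) "with `u₁ = 1`": the class `Λ_k` is a property of ONE gauge
function; the p. 50 sentence is the `u₁ = 1` instance of Proposition 10 (as `B7Prop10Flat` (e) and N-B7-F2 read it), the p. 45
sentence its general form via (178).  (b) Constants: `C₆ = C₅ + 1` of `B7Prop10General` for print's `C₅` (its READING: the `α₀`-terms
of the general-background one-step kernel) and `O(1) = 2C₆` on p. 45; smallness = that of `prop10_general` (at `α₃ = 0` in §3;
explicit, `c₆ = c₆(d, L)` as print allows); `2dα₄ ≤ 1` for the linearisation of §2 follows from `3000(d+1)Lα₄ ≤ 1`.  (c) `η ≥ 0`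
with `Lᵏη ≤ 1` as in the whole package (print: `η = L^{−k}`).  (d) Lattice conventions of `B7Eq167Flat`/`B7Prop9General` (all of
`ℤ^d`, blocks `Lz + [0, L)^d`, tree contours `B7Prop1Explicit.treeWord`, `≤` for `<`, Banach reading of `|·|`, `U1`-valued level
backgrounds as displayed hypotheses `hV`; `u′`, `u₁` arbitrary unit-valued — no unitarity used).
DECLARATIONS: theorems only (no definitions, no new facts); imports `B8Eq178Averages` (for (178) = (179); it carries
`B7Prop10General`).  REUSED BY NAME: `B7Prop10General.utilG, utilG_succ, prop10_general', levels_of52, C6, C4G`, `B7Prop9General.vtilG,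
vtilG_apply, CovBondBd, covBondBd_one_left`, `B7Prop9Flat.SiteBd, BondBd, C5'`, `B7Prop10Flat.C5`, `B7Eq167Flat.InLambda, Cond166,
Cond167, inLambda_one, uavg_one_right`, `B8Eq178Averages.utilG_eq_uavg_mul_inv`, `B7Eq84Concrete.uavg, uavg_succ`, `B7Eq99Concrete.R0avg,
R0fun, savg_const`, `B7Eq92Concrete.Rc, Rc_apply, avgIter_one`, `B7Prop2Explicit.avgIter, AvgClosed, C0, c2', pdev`, `B7Prop1Explicit.hol,
hol_cons, stepHol_true, treeWord, seg_natCast, boxVec, l1, l1_boxVec_le, length_treeWord, disp, disp_cons, disp_treeWord, Letter.vec_true,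
U1, norm_units_conj_sub_one_le, plaqWord`, `B7Prop6Bound.mul_sub_one_norm_le`, `B7Prop6Flat.norm_units_inv_sub_one_le`,
`B8Ineq130.hol_one`.  Unit `lit-balaban-p05` (gen 3), 2026-08-21.

[cite: Balaban1985Averaging, Proposition 10 p.50, p.45 (paragraph after (177)), (203)–(204) p.49, (166)–(167) p.44, (176)–(179) p.45, (182)/(186) p.46, (78)–(80) p.30]
-/

noncomputable section

open NormedSpace Finset

namespace Literature.MathematicalPhysics.QuantumFieldTheory.Balaban1983to89.B7Prop10InLambda

open B7Prop1Explicit B7Prop2Explicit MatrixLog B7Eq92Concrete B7Eq99Concrete B7Eq84Concrete B7Eq167Flat B7Prop8Flat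
  B7Prop9Flat B7Prop10Flat B7Prop9General B7Prop10General

-- `Site` alone would resolve to the torus sites of `Setup.lean`; re-export the `ℤ^d` sites of `B7Prop1Explicit`.
export B7Prop1Explicit (Site)

variable {d : ℕ}

variable {𝔸 : Type*} [NormedRing 𝔸] [NormOneClass 𝔸] [NormedAlgebra ℂ 𝔸] [CompleteSpace 𝔸]

/-! ## §1 With `u₁ = 1` the averages (178)/(179) are the averages (79)/(80) of `u′` -/

omit [NormOneClass 𝔸] in
/-- `\overline{R₀1}(y) = 1`: the twisted block average (78) of the identity gauge function is the identity (every rotated value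
`R(V₀(Γ_{y,x}))1 = 1` and the average of the constant `1` is `1`). [cite: Balaban1985Averaging, (78)–(79) p.30] -/
theorem R0avg_one_right (L : ℕ) (V₀ : Site d → Fin d → 𝔸ˣ) (y : Site d) :
    R0avg L V₀ (1 : Site d → 𝔸ˣ) y = 1 := by
  have h : R0fun V₀ y (1 : Site d → 𝔸ˣ) = fun _ => 1 := by
    funext x; simp
  simp only [R0avg]
  rw [h, savg_const]

omit [NormOneClass 𝔸] in
/-- (178) at `v₁ = 1`: `ṽ′ = \overline{R₀v′·1}(\overline{R₀1})⁻¹ = \overline{R₀v′}` — the one-step object of (179) with the trivial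
auxiliary function is the twisted average (78) of `v′` itself. [cite: Balaban1985Averaging, (178)–(179) p.45, (78) p.30] -/
theorem vtilG_one_right (L : ℕ) (V₀ : Site d → Fin d → 𝔸ˣ) (v' : Site d → 𝔸ˣ) (y : Site d) :
    vtilG L V₀ v' (1 : Site d → 𝔸ˣ) y = R0avg L V₀ v' y := by
  rw [vtilG_apply, mul_one, R0avg_one_right, inv_one, mul_one]

omit [NormOneClass 𝔸] in
/-- **(178)/(179) with `u₁ = 1` are (79)/(80)**: `ũ′ʲ = \overline{R₀u′·1}ʲ(\overline{R₀1}ʲ)⁻¹ = \overline{R₀u′}ʲ` for every `j`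
(`\overline{R₀1}ʲ = 1`, `B7Eq167Flat.uavg_one_right`) — the reading "with `u₁ = 1`" of the sentence after Proposition 10.
[cite: Balaban1985Averaging, (178)–(179) p.45, (79)–(80) p.30, Proposition 10 p.50] -/
theorem utilG_one_right (L : ℕ) (U₀ : Site d → Fin d → 𝔸ˣ) (u' : Site d → 𝔸ˣ) :
    ∀ j : ℕ, utilG L U₀ u' (1 : Site d → 𝔸ˣ) j = uavg L U₀ u' j
  | 0 => rfl
  | j + 1 => by
    funext z
    show vtilG L (avgIter L U₀ j) (utilG L U₀ u' (1 : Site d → 𝔸ˣ) j) (uavg L U₀ (1 : Site d → 𝔸ˣ) j) ((L : ℤ) • z)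
      = R0avg L (avgIter L U₀ j) (uavg L U₀ u' j) ((L : ℤ) • z)
    rw [utilG_one_right L U₀ u' j, uavg_one_right, vtilG_one_right]

/-! ## §2 Covariant telescoping along a word of positive bonds ((182)/(186) p. 46 at a `U1`-valued background) -/

omit [NormOneClass 𝔸] [NormedAlgebra ℂ 𝔸] [CompleteSpace 𝔸] in
/-- One covariant step splits off: `v(x)⁻¹R(S·H)v(x″) = [v(x)⁻¹R(S)v(x′)]·R(S)[v(x′)⁻¹R(H)v(x″)]` (`R(X)R(Y) = R(XY)`, (57) p. 27).
[cite: Balaban1985Averaging, (57) p.27, (186) p.46] -/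
private theorem cov_step_split (S H A B C : 𝔸ˣ) :
    A⁻¹ * Rc (S * H) C = (A⁻¹ * Rc S B) * Rc S (B⁻¹ * Rc H C) := by
  simp only [Rc_apply, mul_inv_rev]
  group

omit [NormedAlgebra ℂ 𝔸] [CompleteSpace 𝔸] in
/-- **Covariant telescoping, product form.**  At a background `V₀` with values in `U1` and a gauge function `v` with the covariant
bond condition (180b) `‖v(b₋)⁻¹R(V₀(b))v(b₊) − 1‖ ≤ a` on all (positive) bonds, for every lattice word `Γ` of POSITIVE letters from `x`:
`‖v(x)⁻¹R(V₀(Γ))v(x + disp Γ) − 1‖ ≤ (1 + a)^{|Γ|} − 1` — print's (186) "`v′⁻¹(y)(R_{0,y}v′)(x) = ∏_{b⊂Γ_{y,x}} R(V₀(Γ_{y,b₋}))V′_b`",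
each factor a rotated (180b)-quantity (rotations by `U1` elements do not increase `‖· − 1‖`), and `‖XY − 1‖ ≤ (1 + ‖X − 1‖)(1 + ‖Y − 1‖) − 1`.
[cite: Balaban1985Averaging, (186) p.46, (182) p.46, (180) p.46, (57) p.27] -/
theorem covWalk_pos {V₀ : Site d → Fin d → 𝔸ˣ} (hV : ∀ x κ, V₀ x κ ∈ U1 𝔸) {v : Site d → 𝔸ˣ} {a : ℝ}
    (hv : CovBondBd V₀ v a) :
    ∀ (w : List (Letter d)) (x : Site d), (∀ l ∈ w, l.2 = true) →
      ‖((((v x)⁻¹ * Rc (hol V₀ x w) (v (x + disp w)) : 𝔸ˣ)) : 𝔸) - 1‖ ≤ (1 + a) ^ w.length - 1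
  | [], x, _ => by simp
  | l :: w, x, hw => by
    obtain ⟨κ, s⟩ := l
    have hs : s = true := hw (κ, s) (by simp)
    subst hs
    have hw' : ∀ l' ∈ w, l'.2 = true := fun l' hl' => hw l' (List.mem_cons_of_mem _ hl')
    have ha0 : 0 ≤ a := (norm_nonneg _).trans (hv x κ)
    -- the word `(κ,+) :: w`: transporter `V₀(x,κ)·V₀(Γ_w from x + e_κ)`, endpoint `x + e_κ + disp w`
    rw [hol_cons, stepHol_true, disp_cons, Letter.vec_true, ← add_assoc,
      cov_step_split (V₀ x κ) (hol V₀ (x + e κ) w) (v x) (v (x + e κ)) (v (x + e κ + disp w)), Units.val_mul]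
    have h1 : ‖((((v x)⁻¹ * Rc (V₀ x κ) (v (x + e κ)) : 𝔸ˣ)) : 𝔸) - 1‖ ≤ a := hv x κ
    have h2 : ‖(((Rc (V₀ x κ) ((v (x + e κ))⁻¹ * Rc (hol V₀ (x + e κ) w) (v (x + e κ + disp w))) : 𝔸ˣ)) : 𝔸) - 1‖
        ≤ (1 + a) ^ w.length - 1 := by
      rw [Rc_apply, Units.val_mul, Units.val_mul]
      exact (norm_units_conj_sub_one_le (hV x κ) _).trans (covWalk_pos hV hv w (x + e κ) hw')
    have hA0 := norm_nonneg (((((v x)⁻¹ * Rc (V₀ x κ) (v (x + e κ)) : 𝔸ˣ)) : 𝔸) - 1)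
    have hB0 := norm_nonneg
      ((((Rc (V₀ x κ) ((v (x + e κ))⁻¹ * Rc (hol V₀ (x + e κ) w) (v (x + e κ + disp w))) : 𝔸ˣ)) : 𝔸) - 1)
    have hpow : (0 : ℝ) ≤ (1 + a) ^ w.length := by positivity
    calc _ ≤ (1 + ‖((((v x)⁻¹ * Rc (V₀ x κ) (v (x + e κ)) : 𝔸ˣ)) : 𝔸) - 1‖) *
          (1 + ‖(((Rc (V₀ x κ) ((v (x + e κ))⁻¹ * Rc (hol V₀ (x + e κ) w) (v (x + e κ + disp w))) : 𝔸ˣ)) : 𝔸) - 1‖) - 1 :=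
        B7Prop6Bound.mul_sub_one_norm_le _ _
      _ ≤ (1 + a) * (1 + ((1 + a) ^ w.length - 1)) - 1 := by
        gcongr
      _ = (1 + a) ^ (w.length + 1) - 1 := by ring
      _ = (1 + a) ^ (((κ, true) :: w).length) - 1 := by rw [List.length_cons]

omit [NormOneClass 𝔸] [NormedAlgebra ℂ 𝔸] [CompleteSpace 𝔸] in
/-- `(1 + a)^n − 1 ≤ 2na` for `0 ≤ a`, `na ≤ 1` (`(1 + a)^n ≤ e^{na}` and `e^t − 1 ≤ 2t` on `[0, 1]`) — print's "`|Γ|α′₄e^{|Γ|α′₄} =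
O(Lα′₄)`" of (182). [cite: Balaban1985Averaging, (182) p.46] -/
private theorem one_add_pow_sub_one_le {a : ℝ} (ha : 0 ≤ a) {n : ℕ} (hn : (n : ℝ) * a ≤ 1) :
    (1 + a) ^ n - 1 ≤ 2 * ((n : ℝ) * a) := by
  have h1 : (1 + a) ^ n ≤ Real.exp ((n : ℝ) * a) := by
    calc (1 + a) ^ n ≤ (Real.exp a) ^ n := by
          gcongr
          have := Real.add_one_le_exp a
          linarith
      _ = Real.exp ((n : ℝ) * a) := by rw [← Real.exp_nat_mul]
  have hna : 0 ≤ (n : ℝ) * a := by positivity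
  have h2 : |Real.exp ((n : ℝ) * a) - 1| ≤ 2 * |(n : ℝ) * a| :=
    Real.abs_exp_sub_one_le (by rw [abs_of_nonneg hna]; exact hn)
  rw [abs_of_nonneg hna] at h2
  have h3 := le_abs_self (Real.exp ((n : ℝ) * a) - 1)
  linarith

omit [NormedAlgebra ℂ 𝔸] [CompleteSpace 𝔸] in
/-- **Covariant telescoping, linear form** (print (182): "`< |Γ_{y,x}|α′₄e^{|Γ_{y,x}|α′₄} = O(Lα′₄)`"): under the hypotheses of
`covWalk_pos`, `0 ≤ a` and `|Γ|a ≤ 1`, `‖v(x)⁻¹R(V₀(Γ))v(x + disp Γ) − 1‖ ≤ 2|Γ|a`. [cite: Balaban1985Averaging, (182) p.46, (186) p.46] -/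
theorem covWalk_pos_linear {V₀ : Site d → Fin d → 𝔸ˣ} (hV : ∀ x κ, V₀ x κ ∈ U1 𝔸) {v : Site d → 𝔸ˣ} {a : ℝ}
    (hv : CovBondBd V₀ v a) (ha : 0 ≤ a) (w : List (Letter d)) (x : Site d) (hw : ∀ l ∈ w, l.2 = true)
    (hn : (w.length : ℝ) * a ≤ 1) :
    ‖((((v x)⁻¹ * Rc (hol V₀ x w) (v (x + disp w)) : 𝔸ˣ)) : 𝔸) - 1‖ ≤ 2 * ((w.length : ℝ) * a) :=
  (covWalk_pos hV hv w x hw).trans (one_add_pow_sub_one_le ha hn)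

omit [NormOneClass 𝔸] [NormedAlgebra ℂ 𝔸] [CompleteSpace 𝔸] in
/-- The tree contour `Γ_{y,y+r}`, `r ∈ [0, L)^d` (`treeWord (boxVec L r)`), is a word of POSITIVE letters (each coordinate segment
`seg κ (r_κ)` with `r_κ ≥ 0` is `r_κ` copies of `(κ, +)`). [cite: Balaban1985Averaging, p.24 (tree contours), (78) p.30] -/
theorem treeWord_boxVec_pos (L : ℕ) (r : Fin d → Fin L) : ∀ l ∈ treeWord (boxVec L r), l.2 = true := by
  intro l hl
  simp only [treeWord, List.mem_flatMap, List.mem_reverse, List.mem_finRange, true_and] at hl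
  obtain ⟨κ, hκ⟩ := hl
  have hseg : seg κ (boxVec L r κ) = List.replicate (r κ : ℕ) (κ, true) := by
    rw [show boxVec L r κ = ((r κ : ℕ) : ℤ) from rfl, seg_natCast]
  rw [hseg] at hκ
  rw [(List.eq_of_mem_replicate hκ)]

omit [NormedAlgebra ℂ 𝔸] [CompleteSpace 𝔸] in
/-- **The (167)/(180d) block quantity from the bond condition (180b)** — N-B7-F2's count: summing the covariant bond deviations
along the tree contour `Γ_{Lz,Lz+r}` (`|Γ| ≤ d(L − 1) ≤ dL` bonds) at a `U1`-valued background,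
`‖v(Lz)⁻¹R(V₀(Γ_{Lz,Lz+r}))v(Lz + r) − 1‖ ≤ 2dL·a` provided `0 ≤ a`, `dL·a ≤ 1`. [cite: Balaban1985Averaging, (167) p.44, (180) p.46, (182) p.46] -/
theorem covBlock_of_covBondBd {L : ℕ} {V₀ : Site d → Fin d → 𝔸ˣ} (hV : ∀ x κ, V₀ x κ ∈ U1 𝔸) {v : Site d → 𝔸ˣ} {a : ℝ}
    (hv : CovBondBd V₀ v a) (ha0 : 0 ≤ a) (hs : (d : ℝ) * L * a ≤ 1) (y : Site d) (r : Fin d → Fin L) :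
    ‖((((v y)⁻¹ * Rc (hol V₀ y (treeWord (boxVec L r))) (v (y + boxVec L r)) : 𝔸ˣ)) : 𝔸) - 1‖
      ≤ 2 * ((d : ℝ) * L * a) := by
  have hlen : ((treeWord (boxVec L r)).length : ℝ) ≤ (d : ℝ) * L := by
    rw [length_treeWord]; exact_mod_cast l1_boxVec_le L r
  have hlen' : ((treeWord (boxVec L r)).length : ℝ) * a ≤ (d : ℝ) * L * a := mul_le_mul_of_nonneg_right hlen ha0
  have h := covWalk_pos_linear hV hv ha0 (treeWord (boxVec L r)) y (treeWord_boxVec_pos L r) (hlen'.trans hs)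
  rw [disp_treeWord] at h
  exact h.trans (by linarith)

/-! ## §3 «u′ belongs to the class Λ_k(C₅α₄)» (p. 50) -/

omit [NormOneClass 𝔸] [NormedAlgebra ℂ 𝔸] [CompleteSpace 𝔸] in
/-- `4d ≤ C₆` (`C₆ = C₅ + 1 = 2 + 256(d + 1)`): the (167)-constant of §2 is absorbed by the (204)-constant. [cite: Balaban1985Averaging, Proposition 10 p.50] -/
private theorem four_d_le_C6 : 4 * (d : ℝ) ≤ C6 d := by
  unfold C6 C5 C5'
  have hd : (0 : ℝ) ≤ d := Nat.cast_nonneg d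
  nlinarith

/-- **p. 50: "This result implies in particular that the configuration `u′` belongs to the class `Λ_k(C₅α₄)`" — AT A GENERAL
BACKGROUND, as a membership statement in the typed class.**  Under the hypotheses of `B7Prop10General.prop10_general` taken with
`u₁ = 1` (hence `α₃ = 0`) — the level backgrounds `Ū₀ʲ`, `j < k`, with values in `U1` and "`α₀` replaced by `2α₀(Lʲη)²`" (p. 49),
(176) `SiteBd u′ α₄`, (177) `CovBondBd U₀ u′ (α₄η)`, `L ≥ 2`, `0 ≤ η`, `Lᵏη ≤ 1`, and the explicit smallness of that theorem —
`u′ ∈ Λ_k(U₀, C₆α₄)`: `B7Eq167Flat.InLambda L U₀ u′ k (C6 d * α₄) η`, i.e. (166) `‖\overline{R₀u′}ʲ − 1‖ ≤ C₆α₄` (`j ≤ k`) and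
(167) `‖(\overline{R₀u′}ʲ)⁻¹(Lz)·R(Ū₀ʲ(Γ_{Lz,Lz+r}))\overline{R₀u′}ʲ(Lz + r) − 1‖ ≤ C₆α₄·L^{j+1}η` (`j < k`).  PROOF = print's sentence
made explicit: (166) is (204) (`prop10_general'`, `≤ C₆α₄`) for `ũ′ʲ = \overline{R₀u′}ʲ` (`utilG_one_right`); (167) is (203)
(`≤ 2α₄Lʲη` on single level-`j` bonds) summed covariantly along the tree contour (`covBlock_of_covBondBd`: `≤ 2dL·2α₄Lʲη =
4d·α₄L^{j+1}η`) and `4d ≤ C₆`.  READING (b) of the module docstring: `C₆ = C₅ + 1` of `B7Prop10General` for print's `C₅`; in these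
constants no `max(C₅, 2d)` (N-B7-F2) is needed. [cite: Balaban1985Averaging, Proposition 10 p.50, (203)–(204) p.49, (166)–(167) p.44, (176)–(179) p.45] -/
theorem inLambda_of_prop10_general {L : ℕ} (hL : 2 ≤ L) {U₀ : Site d → Fin d → 𝔸ˣ} {k : ℕ} {u' : Site d → 𝔸ˣ}
    {α₀ α₄ η : ℝ}
    (hV : ∀ j < k, ∀ (x : Site d) (κ : Fin d), avgIter L U₀ j x κ ∈ U1 𝔸)
    (h52 : ∀ j < k, ∀ (x : Site d) (κ μ : Fin d), κ ≠ μ →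
      ‖((hol (avgIter L U₀ j) x (plaqWord κ μ) : 𝔸ˣ) : 𝔸) - 1‖ ≤ 2 * α₀ * ((L : ℝ) ^ j * η) ^ 2)
    (h176 : SiteBd u' α₄) (h177 : CovBondBd U₀ u' (α₄ * η))
    (hη : 0 ≤ η) (hk : (L : ℝ) ^ k * η ≤ 1) (hα₀ : 0 ≤ α₀) (hα₄ : 0 ≤ α₄)
    (hs₁ : 10 * C6 d * α₄ ≤ 1) (hs₂ : 3000 * ((d : ℝ) + 1) * L * α₄ ≤ 1) (hs₃ : C4G d L * (α₀ + α₄) ≤ 1)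
    (hs₄ : 1024 * ((d : ℝ) + 1) * ((d : ℝ) + 4) * L ^ 2 * α₀ ≤ 1) (hs₅ : 32 * ((d : ℝ) + 1) ^ 2 * C6 d * L ^ 2 * α₀ ≤ 1)
    (hs₆ : 16 * d * C5' d * C6 d * (L : ℝ) ^ 2 * α₀ ≤ 1) :
    InLambda L U₀ u' k (C6 d * α₄) η := by
  have hL1 : 1 ≤ L := le_trans (by norm_num) hL
  have hLr : (1 : ℝ) ≤ L := by exact_mod_cast hL1
  have hd : (0 : ℝ) ≤ d := Nat.cast_nonneg d
  have hs₃' : C4G d L * (α₀ + 0 + α₄) ≤ 1 := by rwa [add_zero]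
  -- Proposition 10 with the auxiliary function `u₁ = 1 ∈ Λ_k(U₀, 0)`
  have hP := prop10_general' hL hV h52 h176 h177 (inLambda_one L U₀ k le_rfl hη) hη hk hα₀ le_rfl
    (by norm_num) hα₄ hs₁ hs₂ hs₃' hs₄ hs₅ hs₆
  refine ⟨fun j hj z => ?_, fun j hj z r => ?_⟩
  · -- (166) = (204)
    have h := (hP j hj).2 z
    rwa [utilG_one_right] at h
  · -- (167) = (203) summed along the tree contour
    have h203 : CovBondBd (avgIter L U₀ j) (uavg L U₀ u' j) (2 * α₄ * ((L : ℝ) ^ j * η)) := by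
      have h := (hP j hj.le).1
      rwa [utilG_one_right] at h
    have ht : (L : ℝ) ^ (j + 1) * η ≤ 1 :=
      le_trans (mul_le_mul_of_nonneg_right (pow_le_pow_right₀ hLr (Nat.succ_le_of_lt hj)) hη) hk
    have ht0 : 0 ≤ (L : ℝ) ^ j * η := by positivity
    have hsmall : (d : ℝ) * L * (2 * α₄ * ((L : ℝ) ^ j * η)) ≤ 1 := by
      have e : (d : ℝ) * L * (2 * α₄ * ((L : ℝ) ^ j * η)) = 2 * d * α₄ * ((L : ℝ) ^ (j + 1) * η) := by ring
      rw [e]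
      have h2d : 2 * (d : ℝ) * α₄ ≤ 1 := by nlinarith
      calc 2 * (d : ℝ) * α₄ * ((L : ℝ) ^ (j + 1) * η) ≤ 1 * 1 :=
            mul_le_mul h2d ht (by positivity) (by norm_num)
        _ = 1 := one_mul 1
    have hw := covBlock_of_covBondBd (hV j hj) h203 (by positivity) hsmall ((L : ℤ) • z) r
    have e : 2 * ((d : ℝ) * L * (2 * α₄ * ((L : ℝ) ^ j * η))) = 4 * d * α₄ * ((L : ℝ) ^ (j + 1) * η) := by ring
    rw [e] at hw
    refine hw.trans ?_
    have hC := four_d_le_C6 (d := d)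
    have hLj : 0 ≤ (L : ℝ) ^ (j + 1) * η := by positivity
    calc 4 * (d : ℝ) * α₄ * ((L : ℝ) ^ (j + 1) * η) = (4 * d) * (α₄ * ((L : ℝ) ^ (j + 1) * η)) := by ring
      _ ≤ C6 d * (α₄ * ((L : ℝ) ^ (j + 1) * η)) := mul_le_mul_of_nonneg_right hC (by positivity)
      _ = C6 d * α₄ * (L : ℝ) ^ (j + 1) * η := by ring

/-- **The sentence UNDER (52)** — the level hypotheses discharged by Proposition 2 (`B7Prop10General.levels_of52`): for `U₀` with
values in an average-closed subgroup `G ⊂ U1` (e.g. the unitary group) with (52) `sup_p‖U₀(∂p) − 1‖ < α₀η²`, `η = L^{−k}`,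
Prop. 2's smallness `C₀α₀ ≤ ⅓`, `2α₀ ≤ c′₂`, and `u′` with (176), (177) and the smallness of `prop10_general`:
`u′ ∈ Λ_k(U₀, C₆α₄)` at `η = L^{−k}`. [cite: Balaban1985Averaging, Proposition 10 p.50, Proposition 2 p.26, (166)–(167) p.44] -/
theorem inLambda_of_prop10_general_of52 {L : ℕ} (hL : 2 ≤ L) {G : Subgroup 𝔸ˣ} (hG : AvgClosed d L G)
    {U₀ : Site d → Fin d → 𝔸ˣ} (hU : ∀ x κ, U₀ x κ ∈ G) {k : ℕ} {u' : Site d → 𝔸ˣ} {α₀ α₄ : ℝ}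
    (hα : 0 < α₀) (hα3 : C0 d * α₀ ≤ 1 / 3) (hα2 : 2 * α₀ ≤ c2' d L)
    (h52 : pdev U₀ < α₀ * (((L : ℝ) ^ k)⁻¹) ^ 2)
    (h176 : SiteBd u' α₄) (h177 : CovBondBd U₀ u' (α₄ * ((L : ℝ) ^ k)⁻¹)) (hα₄ : 0 ≤ α₄)
    (hs₁ : 10 * C6 d * α₄ ≤ 1) (hs₂ : 3000 * ((d : ℝ) + 1) * L * α₄ ≤ 1) (hs₃ : C4G d L * (α₀ + α₄) ≤ 1)
    (hs₄ : 1024 * ((d : ℝ) + 1) * ((d : ℝ) + 4) * L ^ 2 * α₀ ≤ 1) (hs₅ : 32 * ((d : ℝ) + 1) ^ 2 * C6 d * L ^ 2 * α₀ ≤ 1)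
    (hs₆ : 16 * d * C5' d * C6 d * (L : ℝ) ^ 2 * α₀ ≤ 1) :
    InLambda L U₀ u' k (C6 d * α₄) (((L : ℝ) ^ k)⁻¹) := by
  obtain ⟨hV, hP⟩ := levels_of52 hL hG hU k hα hα3 hα2 h52
  have hη : (0 : ℝ) ≤ ((L : ℝ) ^ k)⁻¹ := by positivity
  have hk : (L : ℝ) ^ k * ((L : ℝ) ^ k)⁻¹ ≤ 1 := by rw [mul_inv_cancel₀ (by positivity)]
  exact inLambda_of_prop10_general hL (fun j hj => hV j hj.le) (fun j hj => hP j hj.le) h176 h177 hη hk hα.le hα₄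
    hs₁ hs₂ hs₃ hs₄ hs₅ hs₆

/-- **The sentence AT THE FLAT BACKGROUND `U₀ = 1`** (the setting of `B7Prop10Flat`): (176) `SiteBd u′ α₄`, (177) `BondBd u′ (α₄η)`,
`L ≥ 2`, `0 ≤ η`, `Lᵏη ≤ 1` and the `α₄`-smallness `10C₆α₄ ≤ 1`, `3000(d+1)Lα₄ ≤ 1`, `C₄α₄ ≤ 1` give `u′ ∈ Λ_k(1, C₆α₄)` (all level
backgrounds are `1`, every plaquette holonomy is `1`, so `α₀ = 0`). [cite: Balaban1985Averaging, Proposition 10 p.50, (166)–(167) p.44, (176)–(177) p.45] -/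
theorem inLambda_of_prop10_flat {L : ℕ} (hL : 2 ≤ L) {k : ℕ} {u' : Site d → 𝔸ˣ} {α₄ η : ℝ}
    (h176 : SiteBd u' α₄) (h177 : BondBd u' (α₄ * η))
    (hη : 0 ≤ η) (hk : (L : ℝ) ^ k * η ≤ 1) (hα₄ : 0 ≤ α₄)
    (hs₁ : 10 * C6 d * α₄ ≤ 1) (hs₂ : 3000 * ((d : ℝ) + 1) * L * α₄ ≤ 1) (hs₃ : C4G d L * α₄ ≤ 1) :
    InLambda L (1 : Site d → Fin d → 𝔸ˣ) u' k (C6 d * α₄) η := by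
  have hV : ∀ j < k, ∀ (x : Site d) (κ : Fin d), avgIter L (1 : Site d → Fin d → 𝔸ˣ) j x κ ∈ U1 𝔸 := by
    intro j _ x κ
    rw [avgIter_one]
    exact (U1 𝔸).one_mem
  have h52 : ∀ j < k, ∀ (x : Site d) (κ μ : Fin d), κ ≠ μ →
      ‖((hol (avgIter L (1 : Site d → Fin d → 𝔸ˣ) j) x (plaqWord κ μ) : 𝔸ˣ) : 𝔸) - 1‖
        ≤ 2 * (0 : ℝ) * ((L : ℝ) ^ j * η) ^ 2 := by
    intro j _ x κ μ _
    rw [avgIter_one, B8Ineq130.hol_one]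
    simp
  have h177' : CovBondBd (1 : Site d → Fin d → 𝔸ˣ) u' (α₄ * η) := (covBondBd_one_left u' _).mpr h177
  exact inLambda_of_prop10_general hL hV h52 h176 h177' hη hk le_rfl hα₄ hs₁ hs₂ (by rwa [zero_add])
    (by simp) (by simp) (by simp)


/-! ## §4 p. 45: «the product u′u₁ belongs to some class Λ_k(O(1)(α₃ + α₄))» -/

omit [NormOneClass 𝔸] [NormedAlgebra ℂ 𝔸] [CompleteSpace 𝔸] in
/-- **(182) p. 46 as an identity of units at a general background**: the block quantity of a product splits,
`(v′v₁)(y)⁻¹R(T)(v′v₁)(x) = R(v₁(y)⁻¹)[v′(y)⁻¹R(T)v′(x)]·[v₁(y)⁻¹R(T)v₁(x)]` (print: "`(v′v₁)⁻¹(y)(R_{0,y}v′v₁)(x) =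
R(v₁⁻¹(y))[v′⁻¹(y)(R_{0,y}v′)(x)]·v₁⁻¹(y)(R_{0,y}v₁)(x)`"). [cite: Balaban1985Averaging, (181)–(182) p.46] -/
private theorem prod_cov_split (T A A' B B' : 𝔸ˣ) :
    (A * B)⁻¹ * Rc T (A' * B') = Rc B⁻¹ (A⁻¹ * Rc T A') * (B⁻¹ * Rc T B') := by
  simp only [map_mul, Rc_apply, inv_inv, mul_inv_rev]
  group

omit [NormOneClass 𝔸] [NormedAlgebra ℂ 𝔸] [CompleteSpace 𝔸] in
/-- `C₆ = 2 + 256(d + 1)` (`C₆ = C₅ + 1`, `C₅ = 1 + 4C′₅`, `C′₅ = 64(d + 1)`). [cite: Balaban1985Averaging, Proposition 10 p.50] -/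
private theorem C6_eq : C6 d = 2 + 256 * ((d : ℝ) + 1) := by
  unfold C6 C5 C5'; ring

omit [NormedAlgebra ℂ 𝔸] [CompleteSpace 𝔸] in
/-- The norm bookkeeping of (182): if `‖W − 1‖ ≤ w ≤ 1/50`, `‖A − 1‖ ≤ a`, `‖B − 1‖ ≤ b ≤ 1/50`, then
`‖R(W⁻¹)A·B − 1‖ ≤ (6/5)a + b` (`‖W‖ ≤ 1 + w`, `‖W⁻¹‖ ≤ 1 + 2w`, `‖XY − 1‖ ≤ (1 + ‖X − 1‖)(1 + ‖Y − 1‖) − 1`). [folklore] -/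
private theorem prod_bound {W A B : 𝔸ˣ} {a b w : ℝ} (hW : ‖(W : 𝔸) - 1‖ ≤ w) (hw : w ≤ 1 / 50)
    (hA : ‖(A : 𝔸) - 1‖ ≤ a) (hB : ‖(B : 𝔸) - 1‖ ≤ b) (hb : b ≤ 1 / 50) :
    ‖((Rc W⁻¹ A * B : 𝔸ˣ) : 𝔸) - 1‖ ≤ 6 / 5 * a + b := by
  have hw0 : 0 ≤ w := (norm_nonneg _).trans hW
  have ha0 : 0 ≤ a := (norm_nonneg _).trans hA
  have hb0 : 0 ≤ b := (norm_nonneg _).trans hB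
  have hWn : ‖(W : 𝔸)‖ ≤ 1 + w := by
    calc _ = ‖((W : 𝔸) - 1) + 1‖ := by rw [sub_add_cancel]
      _ ≤ ‖(W : 𝔸) - 1‖ + ‖(1 : 𝔸)‖ := norm_add_le _ _
      _ ≤ 1 + w := by rw [norm_one]; linarith
  have hWin : ‖((W⁻¹ : 𝔸ˣ) : 𝔸)‖ ≤ 1 + 2 * w := by
    have h1 := B7Prop6Flat.norm_units_inv_sub_one_le W (hW.trans (by linarith))
    calc _ = ‖(((W⁻¹ : 𝔸ˣ) : 𝔸) - 1) + 1‖ := by rw [sub_add_cancel]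
      _ ≤ ‖((W⁻¹ : 𝔸ˣ) : 𝔸) - 1‖ + ‖(1 : 𝔸)‖ := norm_add_le _ _
      _ ≤ 1 + 2 * w := by rw [norm_one]; linarith
  have hRcA : ‖((Rc W⁻¹ A : 𝔸ˣ) : 𝔸) - 1‖ ≤ (1 + 2 * w) * a * (1 + w) := by
    have hid : ((Rc W⁻¹ A : 𝔸ˣ) : 𝔸) - 1 = ((W⁻¹ : 𝔸ˣ) : 𝔸) * ((A : 𝔸) - 1) * (W : 𝔸) := by
      rw [Rc_apply, inv_inv, Units.val_mul, Units.val_mul, mul_sub, sub_mul, mul_one, Units.inv_mul]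
    rw [hid]
    have hA0 := norm_nonneg ((A : 𝔸) - 1)
    calc _ ≤ ‖((W⁻¹ : 𝔸ˣ) : 𝔸)‖ * ‖(A : 𝔸) - 1‖ * ‖(W : 𝔸)‖ :=
        (norm_mul_le _ _).trans (mul_le_mul_of_nonneg_right (norm_mul_le _ _) (norm_nonneg _))
      _ ≤ (1 + 2 * w) * a * (1 + w) := by gcongr
  have hX0 := norm_nonneg (((Rc W⁻¹ A : 𝔸ˣ) : 𝔸) - 1)
  have hY0 := norm_nonneg ((B : 𝔸) - 1)
  have hc0 : (1 + 2 * w) * (1 + w) ≤ 11 / 10 := by nlinarith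
  have hc : (1 + 2 * w) * a * (1 + w) ≤ 11 / 10 * a :=
    calc (1 + 2 * w) * a * (1 + w) = ((1 + 2 * w) * (1 + w)) * a := by ring
      _ ≤ 11 / 10 * a := mul_le_mul_of_nonneg_right hc0 ha0
  have hab : (11 / 10 * a) * b ≤ (11 / 10 * a) * (1 / 50) := mul_le_mul_of_nonneg_left hb (by positivity)
  rw [Units.val_mul]
  calc _ ≤ (1 + ‖((Rc W⁻¹ A : 𝔸ˣ) : 𝔸) - 1‖) * (1 + ‖(B : 𝔸) - 1‖) - 1 := B7Prop6Bound.mul_sub_one_norm_le _ _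
    _ ≤ (1 + 11 / 10 * a) * (1 + b) - 1 :=
      sub_le_sub_right (mul_le_mul (by linarith [hRcA.trans hc]) (by linarith) (by positivity) (by positivity)) 1
    _ ≤ 6 / 5 * a + b := by nlinarith

/-- **p. 45: "We would like to know that if `u′` is such a configuration and `u₁` belongs to a class `Λ_k(α₃)`, then the product
`u′u₁` belongs to some class `Λ_k(O(1)(α₃ + α₄))` also"** — the purpose of Propositions 9–10, AS A MEMBERSHIP STATEMENT at a general
background: under the hypotheses of `B7Prop10General.prop10_general` ((176)/(177) for `u′`, `u₁ ∈ Λ_k(U₀, α₃)`, the level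
backgrounds in `U1` with "`α₀` replaced by `2α₀(Lʲη)²`", `L ≥ 2`, `0 ≤ η`, `Lᵏη ≤ 1`, explicit smallness),
`u′u₁ ∈ Λ_k(U₀, 2C₆(α₃ + α₄))`: `InLambda L U₀ (u′ * u₁) k (2 * C6 d * (α₃ + α₄)) η`.  PROOF: by (178) (`\overline{R₀u′u₁}ʲ =
ũ′ʲ·\overline{R₀u₁}ʲ`, `B8Eq178Averages.utilG_eq_uavg_mul_inv`), (166) for the product is (204) × (166):
`(1 + C₆α₄)(1 + α₃) − 1 ≤ 2C₆(α₃ + α₄)`; (167) for the product is (182): the product block quantity is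
`R(ū₁ʲ(y)⁻¹)[ũ′-quantity]·[ū₁-quantity]`, the first within `4dα₄L^{j+1}η` of `1` ((203) summed along the tree contour, §2; the
rotation costs the factor `‖ū₁ʲ(y)⁻¹‖‖ū₁ʲ(y)‖ ≤ (1 + 2α₃)(1 + α₃)`), the second within `α₃L^{j+1}η` ((167) for `u₁`):
`≤ (6/5)·4dα₄L^{j+1}η + α₃L^{j+1}η ≤ 2C₆(α₃ + α₄)L^{j+1}η`; the `O(1)` is `2C₆` in the tree's constants.
[cite: Balaban1985Averaging, p.45 (paragraph after (177)), Proposition 10 p.50, (178) p.45, (182) p.46, (166)–(167) p.44] -/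
theorem inLambda_mul_of_prop10_general {L : ℕ} (hL : 2 ≤ L) {U₀ : Site d → Fin d → 𝔸ˣ} {k : ℕ} {u' u₁ : Site d → 𝔸ˣ}
    {α₀ α₃ α₄ η : ℝ}
    (hV : ∀ j < k, ∀ (x : Site d) (κ : Fin d), avgIter L U₀ j x κ ∈ U1 𝔸)
    (h52 : ∀ j < k, ∀ (x : Site d) (κ μ : Fin d), κ ≠ μ →
      ‖((hol (avgIter L U₀ j) x (plaqWord κ μ) : 𝔸ˣ) : 𝔸) - 1‖ ≤ 2 * α₀ * ((L : ℝ) ^ j * η) ^ 2)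
    (h176 : SiteBd u' α₄) (h177 : CovBondBd U₀ u' (α₄ * η)) (hu₁ : InLambda L U₀ u₁ k α₃ η)
    (hη : 0 ≤ η) (hk : (L : ℝ) ^ k * η ≤ 1) (hα₀ : 0 ≤ α₀) (hα₃ : 0 ≤ α₃) (hα₃' : α₃ ≤ 1 / 50) (hα₄ : 0 ≤ α₄)
    (hs₁ : 10 * C6 d * α₄ ≤ 1) (hs₂ : 3000 * ((d : ℝ) + 1) * L * α₄ ≤ 1) (hs₃ : C4G d L * (α₀ + α₃ + α₄) ≤ 1)
    (hs₄ : 1024 * ((d : ℝ) + 1) * ((d : ℝ) + 4) * L ^ 2 * α₀ ≤ 1) (hs₅ : 32 * ((d : ℝ) + 1) ^ 2 * C6 d * L ^ 2 * α₀ ≤ 1)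
    (hs₆ : 16 * d * C5' d * C6 d * (L : ℝ) ^ 2 * α₀ ≤ 1) :
    InLambda L U₀ (u' * u₁) k (2 * C6 d * (α₃ + α₄)) η := by
  have hL1 : 1 ≤ L := le_trans (by norm_num) hL
  have hLr : (1 : ℝ) ≤ L := by exact_mod_cast hL1
  have hd : (0 : ℝ) ≤ d := Nat.cast_nonneg d
  have hC6 := C6_eq (d := d)
  have hC60 : (0 : ℝ) ≤ C6 d := by rw [hC6]; positivity
  have hP := prop10_general' hL hV h52 h176 h177 hu₁ hη hk hα₀ hα₃ hα₃' hα₄ hs₁ hs₂ hs₃ hs₄ hs₅ hs₆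
  -- (178): `\overline{R₀u′u₁}ʲ = ũ′ʲ·\overline{R₀u₁}ʲ`
  have hfun : ∀ j, uavg L U₀ (u' * u₁) j = utilG L U₀ u' u₁ j * uavg L U₀ u₁ j := by
    intro j; funext z
    rw [Pi.mul_apply, B8Eq178Averages.utilG_eq_uavg_mul_inv, inv_mul_cancel_right]
  refine ⟨fun j hj z => ?_, fun j hj z r => ?_⟩
  · -- (166) for the product
    have hU : ‖((utilG L U₀ u' u₁ j z : 𝔸ˣ) : 𝔸) - 1‖ ≤ C6 d * α₄ := (hP j hj).2 z
    have hW : ‖((uavg L U₀ u₁ j z : 𝔸ˣ) : 𝔸) - 1‖ ≤ α₃ := hu₁.1 j hj z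
    rw [hfun j, Pi.mul_apply, Units.val_mul]
    have hX0 := norm_nonneg (((utilG L U₀ u' u₁ j z : 𝔸ˣ) : 𝔸) - 1)
    have hca : C6 d * α₄ * α₃ ≤ α₃ / 10 := by nlinarith
    calc _ ≤ (1 + ‖((utilG L U₀ u' u₁ j z : 𝔸ˣ) : 𝔸) - 1‖) * (1 + ‖((uavg L U₀ u₁ j z : 𝔸ˣ) : 𝔸) - 1‖) - 1 :=
        B7Prop6Bound.mul_sub_one_norm_le _ _
      _ ≤ (1 + C6 d * α₄) * (1 + α₃) - 1 :=
        sub_le_sub_right (mul_le_mul (by linarith) (by linarith) (by positivity)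
          (by linarith [mul_nonneg hC60 hα₄])) 1
      _ ≤ 2 * C6 d * (α₃ + α₄) := by nlinarith
  · -- (167) for the product, `j < k`
    have ht : (L : ℝ) ^ (j + 1) * η ≤ 1 :=
      le_trans (mul_le_mul_of_nonneg_right (pow_le_pow_right₀ hLr (Nat.succ_le_of_lt hj)) hη) hk
    have ht0 : 0 ≤ (L : ℝ) ^ (j + 1) * η := by positivity
    -- the `ũ′ʲ`-quantity: (203) summed along the tree contour (§2)
    have h203 : CovBondBd (avgIter L U₀ j) (utilG L U₀ u' u₁ j) (2 * α₄ * ((L : ℝ) ^ j * η)) := (hP j hj.le).1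
    have hsmall : (d : ℝ) * L * (2 * α₄ * ((L : ℝ) ^ j * η)) ≤ 1 := by
      have e : (d : ℝ) * L * (2 * α₄ * ((L : ℝ) ^ j * η)) = 2 * d * α₄ * ((L : ℝ) ^ (j + 1) * η) := by ring
      rw [e]
      have h2d : 2 * (d : ℝ) * α₄ ≤ 1 := by nlinarith
      calc 2 * (d : ℝ) * α₄ * ((L : ℝ) ^ (j + 1) * η) ≤ 1 * 1 :=
            mul_le_mul h2d ht (by positivity) (by norm_num)
        _ = 1 := one_mul 1
    have hA := covBlock_of_covBondBd (hV j hj) h203 (by positivity) hsmall ((L : ℤ) • z) r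
    have e : 2 * ((d : ℝ) * L * (2 * α₄ * ((L : ℝ) ^ j * η))) = 4 * d * α₄ * ((L : ℝ) ^ (j + 1) * η) := by ring
    rw [e] at hA
    -- the `ū₁ʲ`-quantity: (167) for `u₁`; and `‖ū₁ʲ(y) − 1‖ ≤ α₃` ((166) for `u₁`)
    have hB := hu₁.2 j hj z r
    have hWy : ‖((uavg L U₀ u₁ j ((L : ℤ) • z) : 𝔸ˣ) : 𝔸) - 1‖ ≤ α₃ := hu₁.1 j hj.le _
    have hb : α₃ * (L : ℝ) ^ (j + 1) * η ≤ 1 / 50 := by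
      rw [mul_assoc]
      calc α₃ * ((L : ℝ) ^ (j + 1) * η) ≤ 1 / 50 * 1 := mul_le_mul hα₃' ht ht0 (by norm_num)
        _ = 1 / 50 := by norm_num
    -- assemble by (182)
    rw [hfun j, Pi.mul_apply, Pi.mul_apply, prod_cov_split]
    refine (prod_bound hWy hα₃' hA hB hb).trans ?_
    rw [hC6]
    nlinarith [mul_nonneg hα₃ ht0, mul_nonneg hα₄ ht0, mul_nonneg (mul_nonneg hd hα₃) ht0,
      mul_nonneg (mul_nonneg hd hα₄) ht0]

end Literature.MathematicalPhysics.QuantumFieldTheory.Balaban1983to89.B7Prop10InLambda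

end
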